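import Literature.Computability.Cryptography.OracleAdversaryPrecomp
import Literature.Computability.Cryptography.PRGStretchExtensionReduction
import HarnessLib

/-!
# PPT oracle adversaries are closed under randomised polynomial-time preprocessing

`OracleAdversaryPrecomp.lean` gives, for a PPT oracle adversary `𝒜` and a polynomial-time map `g`,
the adversary "on input `w`, run `𝒜` on `g w`" (`OracleAdversary.precomp`). Reductions routinely
need the RANDOMISED form "on input `w`, toss coins `c`, run `𝒜` on `g(w, c)`" — guessing an index of a
hybrid argument (Goldreich 2001, proof of Thm. 3.3.3: "algorithm `D'` … selects `k` uniformly in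
`{0, …, p(n) − 1}`, selects `β` uniformly in `{0,1}^k` … and outputs `D(β · …)`"), guessing the value
of an `O(log n)`-bit advice (Håstad–Impagliazzo–Levin–Luby 1999, Prop. 4.8.1: "`M^{(A)}(i)` … since
this works with respect to all `i`, in particular it works when `i = a_n`"), or sampling the part of
a hybrid distribution the reduction fills in itself. In the transcript model of `OracleGames.lean`
(an adversary = a deterministic step function run on `⟨input, coins⟩` with a polynomial coin budget
and a polynomial round budget in the input length) this is the combinator of the present file:

* `OracleAdversary.withCoinPrefix 𝒜 k` — on input `w` with coins `r`, split `r = c · r'` with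
  `|c| = k(|w|)` and run `𝒜` on the INPUT `⟨w, c⟩` with the COINS `r'`
  (`coinPrefixT`, the re-pairing `⟨w, c · r'⟩ ↦ ⟨⟨w, c⟩, r'⟩`, read through `OracleAlg.comap`); its
  budgets are those of `𝒜` at the input length `|⟨w, c⟩| = 2|w| + 2 + k(|w|)` (`cpLen k`), plus `k`
  coins;
* **`OracleAdversary.outputPMF_withCoinPrefix`** — its output law on `w`, for every deterministic
  oracle, is the mixture over a uniform `c ∈ {0,1}^{k(|w|)}` of the output laws of `𝒜` on `⟨w, c⟩`
  (the coin string of the right total length splits into two independent uniform strings,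
  `PRGStretch.uniformBits_add`);
* `OracleAdversary.toReal_toOuterMeasure_withCoinPrefix` — the same law for the probability of an
  event, as a uniform average (`uniformAvg`) over the prefix
  (`toReal_toOuterMeasure_bind_uniformBits`);
* `OracleAdversary.isPPT_withCoinPrefix` — it is PPT when `𝒜` is (`OracleAlg.isPolyTime_comap`; the
  re-pairing is the `FP` map `fanoutFn (truncSndFn k) (sndF ∘ dropSndFn k)`, `CoinTruncation.lean`);
* **`OracleAdversary.exists_ppt_outputPMF_rprecomp`** — the randomised preprocessing closure: for PPT
  `𝒜`, polynomial-time `g` and a polynomial `k` there is a PPT `ℬ` with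
  `ℬ.outputPMF O w = 𝔼_{c ← U_{k(|w|)}} 𝒜.outputPMF O (g ⟨w, c⟩)` for every oracle `O` and input `w`
  (`withCoinPrefix` after `precomp`), together with its `uniformAvg` form for events.

## References

* O. Goldreich, *Foundations of Cryptography I*, CUP 2001, §3.6 (Def. 3.6.4: probabilistic
  polynomial-time oracle machines), Thm. 3.3.3 (proof: the randomised reduction `D'`).
* J. Håstad, R. Impagliazzo, L. A. Levin, M. Luby, SIAM J. Comput. 28 (1999), Prop. 4.8.1 (proof:
  the oracle machines `M^{(A)}(i)`).
* S. Arora, B. Barak, *Computational Complexity: A Modern Approach*, CUP 2009, Def. 7.1 with §3.4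
  (probabilistic machines as deterministic machines reading a random tape; independent segments of
  the tape), Thm. 2.8 (proof: composition of polynomial-time maps).
-/

noncomputable section

namespace Literature.Computability.Cryptography

open _root_.Computability Complexity Complexity.Brick PRGStretch PRGTrunc

/-! ### Averaging over a uniform bit string -/

/-- A `PMF` gives every set outer measure at most `1`. [Mathlib `PMF.toOuterMeasure_apply_eq_one_iff`] [folklore] -/
private theorem toOuterMeasure_apply_le_one'' {γ : Type} (p : PMF γ) (S : Set γ) : p.toOuterMeasure S ≤ 1 :=
  calc p.toOuterMeasure S ≤ p.toOuterMeasure Set.univ := p.toOuterMeasure.mono (Set.subset_univ _)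
    _ = 1 := (PMF.toOuterMeasure_apply_eq_one_iff _ _).2 (Set.subset_univ _)

/-- **The probability of an event under a mixture over `U_n`** is the uniform average of the
probabilities: `((U_n >>= f)(S)) = 2⁻ⁿ ∑_{c ∈ {0,1}ⁿ} f(c)(S)`. [cite: AroraBarakCC2009, Def. 7.1 (probability over the random tape as a fraction of tapes)] -/
theorem toReal_toOuterMeasure_bind_uniformBits {γ : Type} (n : ℕ) (f : List Bool → PMF γ) (S : Set γ) :
    (((uniformBits n).bind f).toOuterMeasure S).toReal =
      uniformAvg n (fun c => ((f c).toOuterMeasure S).toReal) := by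
  rw [uniformBits, PMF.bind_map, PMF.toOuterMeasure_bind_apply, tsum_fintype, uniformAvg]
  have hne : ∀ v : List.Vector Bool n,
      PMF.uniformOfFintype (List.Vector Bool n) v * ((f ∘ List.Vector.toList) v).toOuterMeasure S ≠ ⊤ :=
    fun v => ENNReal.mul_ne_top (by simp [PMF.uniformOfFintype_apply])
      (ne_top_of_le_ne_top ENNReal.one_ne_top (toOuterMeasure_apply_le_one'' _ _))
  rw [ENNReal.toReal_sum fun v _ => hne v]
  simp_rw [ENNReal.toReal_mul, PMF.uniformOfFintype_apply, ENNReal.toReal_inv, ENNReal.toReal_natCast,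
    card_vector, Fintype.card_bool, Function.comp_apply]
  rw [Finset.sum_div]
  refine Finset.sum_congr rfl fun v _ => ?_
  rw [div_eq_inv_mul]
  push_cast
  ring

namespace OracleAdversary

variable {β : Type}

/-! ### The re-pairing of input and coins -/

/-- The re-pairing `⟨w, r⟩ ↦ ⟨⟨w, r ↾ k(|w|)⟩, r ⇂ k(|w|)⟩` as a string function: the first `k(|w|)`
coins become the second component of the input, the remaining coins stay coins
(`fanoutFn (truncSndFn k) (sndF ∘ dropSndFn k)`). [cite: AroraBarakCC2009, Def. 7.1 with §3.4 (segments of the random tape)] -/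
def coinPrefixT (k : Polynomial ℕ) : List Bool → List Bool :=
  fanoutFn (truncSndFn k) (sndF ∘ dropSndFn k)

/-- On a genuine input-and-coins pair: `coinPrefixT k ⟨w, r⟩ = ⟨⟨w, r ↾ k(|w|)⟩, r ⇂ k(|w|)⟩`. [folklore] -/
@[simp] theorem coinPrefixT_boolPair (k : Polynomial ℕ) (w r : List Bool) :
    coinPrefixT k (boolPair w r) =
      boolPair (boolPair w (r.take (k.eval w.length))) (r.drop (k.eval w.length)) := by
  simp [coinPrefixT, fanoutFn_apply, truncSndFn_boolPair, dropSndFn_boolPair]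

/-- The re-pairing is polynomial-time (`truncSndFn_mem_FP`, `dropSndFn_mem_FP`, `fanoutFn_mem_FP`).
[cite: AroraBarakCC2009, Thm. 2.8 (proof: composition)] -/
theorem coinPrefixT_mem_FP (k : Polynomial ℕ) : coinPrefixT k ∈ FP :=
  fanoutFn_mem_FP (truncSndFn_mem_FP k) (comp_mem_FP sndF_mem_FP (dropSndFn_mem_FP k))

/-- `cpLen k = 2X + 2 + k`: the input length `|⟨w, c⟩|` of the emulated adversary as a polynomial in
`|w|` (`length_boolPair`). [folklore] -/
def cpLen (k : Polynomial ℕ) : Polynomial ℕ := 2 * Polynomial.X + 2 + k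

/-- Value of `cpLen`. [folklore] -/
@[simp] theorem cpLen_eval (k : Polynomial ℕ) (n : ℕ) : (cpLen k).eval n = 2 * n + 2 + k.eval n := by
  simp [cpLen]

/-- `|⟨w, c⟩| = cpLen k (|w|)` for a prefix of the right length. [folklore] -/
theorem length_boolPair_eq_cpLen (k : Polynomial ℕ) (w c : List Bool) (hc : c.length = k.eval w.length) :
    (boolPair w c).length = (cpLen k).eval w.length := by
  rw [length_boolPair, cpLen_eval, hc]

/-! ### The adversary reading a coin prefix as input -/

/-- **`𝒜.withCoinPrefix k`**: on input `w` with coins `r = c · r'`, `|c| = k(|w|)`, run `𝒜` on input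
`⟨w, c⟩` with coins `r'` — the step function of `𝒜` read through `coinPrefixT k`, with `k(|w|)` extra
coins and the budgets of `𝒜` at input length `cpLen k (|w|)`. The oracle-adversary form of "toss the
coins `c` yourself and hand them to the emulated machine as part of its input".
[cite: Goldreich2001, §3.6 Def. 3.6.4 with Thm. 3.3.3 (proof: D' selects k and β at random)] -/
def withCoinPrefix (𝒜 : OracleAdversary β) (k : Polynomial ℕ) : OracleAdversary β where
  alg := 𝒜.alg.comap (coinPrefixT k)
  coins := k + 𝒜.coins.comp (cpLen k)
  fuel := 𝒜.fuel.comp (cpLen k)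

/-- Coin budget of `withCoinPrefix`. [folklore] -/
@[simp] theorem coins_withCoinPrefix_eval (𝒜 : OracleAdversary β) (k : Polynomial ℕ) (n : ℕ) :
    (𝒜.withCoinPrefix k).coins.eval n = k.eval n + 𝒜.coins.eval (2 * n + 2 + k.eval n) := by
  simp [withCoinPrefix, Polynomial.eval_comp]

/-- Round budget of `withCoinPrefix`. [folklore] -/
@[simp] theorem fuel_withCoinPrefix_eval (𝒜 : OracleAdversary β) (k : Polynomial ℕ) (n : ℕ) :
    (𝒜.withCoinPrefix k).fuel.eval n = 𝒜.fuel.eval (2 * n + 2 + k.eval n) := by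
  simp [withCoinPrefix, Polynomial.eval_comp]

/-- **The deterministic run**: on `⟨w, r⟩` the new adversary runs `𝒜` on `⟨⟨w, r ↾ k(|w|)⟩, r ⇂ k(|w|)⟩`
with the same fuel (`OracleAlg.runAux_comap`). [cite: AroraBarakCC2009, §3.4] -/
theorem run_withCoinPrefix_boolPair (𝒜 : OracleAdversary β) (k : Polynomial ℕ) (O : Oracle)
    (w r : List Bool) (K : ℕ) :
    (𝒜.withCoinPrefix k).alg.run O K (boolPair w r) =
      𝒜.alg.run O K (boolPair (boolPair w (r.take (k.eval w.length))) (r.drop (k.eval w.length))) := by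
  change (𝒜.alg.comap (coinPrefixT k)).runAux O (boolPair w r) K [] = 𝒜.alg.runAux O _ K []
  rw [OracleAlg.runAux_comap, coinPrefixT_boolPair]

/-- The output law of an oracle adversary as the push-forward of `U_{coins(|x|)}` under its
deterministic run. [cite: AroraBarakCC2009, Def. 7.1] -/
theorem outputPMF_eq_map_uniformBits (𝒜 : OracleAdversary β) (O : Oracle) (x : List Bool) :
    𝒜.outputPMF O x =
      (uniformBits (𝒜.coins.eval x.length)).map fun r => 𝒜.alg.run O (𝒜.fuel.eval x.length) (boolPair x r) := by
  rw [uniformBits, PMF.map_comp, outputPMF_eq_map]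
  rfl

/-- **The output law of `withCoinPrefix`**: for every deterministic oracle and input `w`, the mixture
over a uniform prefix `c ← U_{k(|w|)}` of the laws of `𝒜` on `⟨w, c⟩` — the coin string
`r ← U_{k(|w|) + coins(cpLen k |w|)}` splits as `c · r'` into independent uniform strings
(`uniformBits_add`), and `r'` has exactly the length `𝒜` draws on `⟨w, c⟩`.
[cite: AroraBarakCC2009, Def. 7.1 with §3.4 (independent segments of the random tape)] -/
theorem outputPMF_withCoinPrefix (𝒜 : OracleAdversary β) (k : Polynomial ℕ) (O : Oracle) (w : List Bool) :
    (𝒜.withCoinPrefix k).outputPMF O w =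
      (uniformBits (k.eval w.length)).bind fun c => 𝒜.outputPMF O (boolPair w c) := by
  rw [outputPMF_eq_map_uniformBits, coins_withCoinPrefix_eval, fuel_withCoinPrefix_eval,
    ← uniformBits_add, PMF.map_bind]
  refine pmf_bind_congr_of_mem_support _ fun c hc => ?_
  have hcl : c.length = k.eval w.length := length_eq_of_mem_support_uniformBits hc
  rw [PMF.map_comp, outputPMF_eq_map_uniformBits, length_boolPair, hcl]
  refine congrArg (fun f => PMF.map f (uniformBits (𝒜.coins.eval (2 * w.length + 2 + k.eval w.length))))
    (funext fun y => ?_)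
  simp only [Function.comp_apply]
  rw [run_withCoinPrefix_boolPair, List.take_append_of_le_length hcl.ge, List.take_of_length_le hcl.le,
    List.drop_append_of_le_length hcl.ge, List.drop_of_length_le hcl.le, List.nil_append]

/-- **The probability of an event under `withCoinPrefix`** is the uniform average over the prefix of
the probabilities under `𝒜`. [cite: AroraBarakCC2009, Def. 7.1] -/
theorem toReal_toOuterMeasure_withCoinPrefix (𝒜 : OracleAdversary β) (k : Polynomial ℕ) (O : Oracle)
    (w : List Bool) (S : Set (Option β)) :
    (((𝒜.withCoinPrefix k).outputPMF O w).toOuterMeasure S).toReal =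
      uniformAvg (k.eval w.length) (fun c => ((𝒜.outputPMF O (boolPair w c)).toOuterMeasure S).toReal) := by
  rw [outputPMF_withCoinPrefix, toReal_toOuterMeasure_bind_uniformBits]

/-- **`withCoinPrefix` preserves PPT** (`OracleAlg.isPolyTime_comap` with the `FP` re-pairing; the
budgets are polynomials by construction). [cite: AroraBarakCC2009, Thm. 2.8 (proof) and Def. 7.1] -/
theorem isPPT_withCoinPrefix (𝒜 : OracleAdversary β) (eb : Encoding β Bool) (h𝒜 : 𝒜.IsPPT eb)
    (k : Polynomial ℕ) : (𝒜.withCoinPrefix k).IsPPT eb :=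
  OracleAlg.isPolyTime_comap eb h𝒜 (coinPrefixT_mem_FP k)

/-! ### Randomised preprocessing -/

/-- **PPT oracle adversaries are closed under randomised polynomial-time preprocessing**: for PPT
`𝒜`, polynomial-time `g` and a polynomial `k` there is a PPT adversary `ℬ` which on input `w`, for
every deterministic oracle, behaves as "draw `c ← U_{k(|w|)}` and run `𝒜` on `g ⟨w, c⟩`": its output
law is the mixture of the laws of `𝒜` on `g ⟨w, c⟩`, and the probability of any event is the uniform
average over `c` (`withCoinPrefix` after `precomp`). [cite: Goldreich2001, Thm. 3.3.3 (proof: algorithm D') with §3.6 Def. 3.6.4]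
[cite: HastadImpagliazzoLevinLuby1999, Prop. 4.8.1 (proof: M^{(A)}(i) generates the other seeds at random)] -/
theorem exists_ppt_outputPMF_rprecomp {eb : Encoding β Bool} (𝒜 : OracleAdversary β) (h𝒜 : 𝒜.IsPPT eb)
    {g : List Bool → List Bool} (hg : g ∈ FP) (k : Polynomial ℕ) :
    ∃ ℬ : OracleAdversary β, ℬ.IsPPT eb ∧
      (∀ (O : Oracle) (w : List Bool),
        ℬ.outputPMF O w = (uniformBits (k.eval w.length)).bind fun c => 𝒜.outputPMF O (g (boolPair w c))) ∧
      ∀ (O : Oracle) (w : List Bool) (S : Set (Option β)),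
        ((ℬ.outputPMF O w).toOuterMeasure S).toReal =
          uniformAvg (k.eval w.length) (fun c => ((𝒜.outputPMF O (g (boolPair w c))).toOuterMeasure S).toReal) := by
  obtain ⟨𝒜', h𝒜', hlaw⟩ := 𝒜.exists_ppt_outputPMF_precomp h𝒜 hg
  have hbind : ∀ (O : Oracle) (w : List Bool), (𝒜'.withCoinPrefix k).outputPMF O w =
      (uniformBits (k.eval w.length)).bind fun c => 𝒜.outputPMF O (g (boolPair w c)) := fun O w => by
    rw [outputPMF_withCoinPrefix]
    exact congrArg _ (funext fun c => hlaw O _)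
  refine ⟨𝒜'.withCoinPrefix k, 𝒜'.isPPT_withCoinPrefix eb h𝒜' k, hbind, fun O w S => ?_⟩
  rw [hbind, toReal_toOuterMeasure_bind_uniformBits]

end OracleAdversary

end Literature.Computability.Cryptography

end
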